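import Literature.MathematicalPhysics.QuantumFieldTheory.Balaban1983to89.B2Eq273GaugeCovariance
import Literature.MathematicalPhysics.QuantumFieldTheory.Balaban1983to89.B1Cor23RegularRegion

/-!
# `Balaban1983to89.B2Eq273NeumannLocality` — [Balaban1982Higgs2] Lemma 2.4, proof steps **(2.73)–(2.74)** p. 573 AS PRINTED
# («G_k(□, A₀; x, x′) = U(A₀(Γ_{x,y}))G_k(□, 0; x, x′)U(A₀(Γ_{y,x′})) (2.73)», «(a_kG_k(□, A₀)Q_k^*(A₀)□₁φ)(x) =
# U(A₀(Γ_{x,y}))(a_kG_k(□, 0)Q_k^*□₁φ′)(x) (2.74)») ON THE (Higgs)₂,₃ CARRIER OF RECORD, from own `B2Eq273GaugeCovariance` and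
# the LOCALITY IN THE FIELD of the Neumann operators of [Balaban1982Higgs1] (2.20) «on functions φ : Ω → R^N»: for `Ω` a
# union of `k`-blocks, `H_k(Ω, A)u`, `G^ε_k(Ω, A)u` (`u` supported in `Ω`), `Q_k(A)u`, `Q_k^*(A)ψ` and the background field
# (2.56) depend on `A` only through the bonds INSIDE `Ω` — because every bond of the composite contour `Γ^{(k)}_{y,x}` lies
# in the block `Bᵏ(y)`

statement-level skeleton of published theorems with citation tags; proofs where landed; nothing here is a claim
about the Yang–Mills mass gap

PDF held: `paper:balaban1982-cmp86-higgs23-ii` (journal page = PDF page + 554), p. 573 [PDF 19] (text layer p0019 L12–17,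
re-read this session); [Balaban1982Higgs1] `paper:balaban1982-cmp85-higgs23-i` p. 608 (2.1)–(2.3), p. 610 (2.17)/(2.20)
«for an arbitrary function f : Ω → R^N».

CITATION HEADER (lean-in-tree rule).  T. Bałaban, *(Higgs)₂,₃ quantum fields in a finite volume. II. An upper bound*,
Commun. Math. Phys. **86** (1982) 555–594, doi:10.1007/bf01214890 [Balaban1982Higgs2]; operators of T. Bałaban, *(Higgs)₂,₃
quantum fields in a finite volume. I. A lower bound*, Commun. Math. Phys. **85** (1982) 603–626 [Balaban1982Higgs1] AS TYPED
by the typer (`HiggsLattice`, `HiggsAveraging`, `HiggsCovariance`, `HiggsCovariancePos`, `B2Eq255Concrete`).  Cell `lit-balaban`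
(HOME `run/shared/lean/pub/lit-balaban/`), Phase-2 proof seat **p23** gen 21 (unit `lit-balaban-p23-g21`; free-target protocol
G.5-34(d), TAKING #2 line HOME/STATUS.md 2026-08-23T02:3xZ); SKELETON row **B2.Lem2.4** (Lemma 2.4 (2.65)–(2.66) p. 572; fold
owner r02, second reader r14; decl of record `B2.Lemma24Printed`, head `proved p250408 · …` UNCHANGED — cells-only member;
brick F2 of the seat's programme «(2.68)/(2.65) on the (Higgs)₂,₃ carrier of record», after F1 = own `B2Eq273GaugeCovariance`
p348673 ✓ 77f594e2c6c4).  Cross-references: rows **B1.Eq2.20** (the operators), **B1.Eq2.1** (contours), **B2.Eq2.55** ((2.56)).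
USED BY NAME, never restated: own `B2Eq273GaugeCovariance.{constVec, cornerGauge, seamField, seamField_eq_zero_of_noWrap,
kernel_propagatorK_constVec, bgScalar256_constVec, U_cornerGauge}`, p35's `B1Cor23RegularRegion.propagatorK_supported`
(`G^ε_k(Ω,A)` maps `Ω`-supported fields to `Ω`-supported fields) and `HiggsCovariancePos.{Inside, shift_unshift,
covOpK_propagatorK_apply, propagatorK_covOpK_apply}`, own gen 9's `B2Ineq329PrismHolonomy.{blockIter_stair_src, corner_eq_cornerN,
shiftN_cornerN_succ, val_toFinest, val_toFinest_blockIter}`, p15's `B2Ineq329ZeroAveraging.{val_blockIter, sitesPerDir_zero_eq}`,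
p17's `B2Restr216Lattice.{cornerN, shiftN_succ}`, the typer's `B2Eq255Concrete.{bgScalar256_eq, underRegion, mem_underRegion,
cutTo_of_not_mem}`.

WHAT IS PRINTED (p. 573 [PDF 19]).  *«Hence the operator −Δ^{η,N}_{A₀,□} + m²(Lᵏε)² + a_kP_k(A₀)□ is transformed into the operator
−Δ^{η,N}_{0,□} + m²(Lᵏε)² + a_kP_k□, and we have G_k(□, A₀; x, x′) = U(A₀(Γ_{x,y}))G_k(□, 0; x, x′)U(A₀(Γ_{y,x′})). (2.73)
Together with the gauge transformation of the propagators we make the corresponding transformation of the field φ, i.e.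
φ(y′) = U(A₀(Γ_{y′,y}))φ′(y′). Then the last expression in (2.68) transforms itself as follows (a_kG_k(□, A₀)Q_k^*(A₀)□₁φ)(x) =
U(A₀(Γ_{x,y}))(a_kG_k(□, 0)Q_k^*□₁φ′)(x). (2.74)»*; [B1] p. 610: *«G^ε_k(Ω, A) = (−Δ^{ε,N}_{A,Ω} + m² + a_k(Lᵏε)^{−2}P_k(A))^{−1},
P_k(A) = Q_k^*(A)Q_k(A) (2.20) … for an arbitrary function f : Ω → R^N»*.

THE ARGUMENT (ours; print treats `G_k(□, A)` as an operator on functions on `□` and never states locality).  On the carrier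
the operator of (2.20) acts on ALL fields of the torus `T_ε` (the Neumann Laplacian keeps the bonds inside `Ω`; `m²` and
`a_k(Lᵏε)⁻²P_k(A)` act everywhere), and F1's exact identity `G^ε_k(Ω, A₀ + A′; x, x′) = U(A₀(Γ_{x,o}))G^ε_k(Ω, A′ + (A₀ − ∂λ_o); x, x′)
U(A₀(Γ_{o,x′}))` carries the seam field `A₀ − ∂λ_o` of the corner gauge (a constant field is not a pure gauge on the torus).
(i) GEOMETRY: every bond of the typer's composite contour `Γ^{(k)}_{y,x}` — the straight segments between the corners
`toFinest x_{i+1}`, `toFinest x_i` of the nested blocks of `x` — starts (own gen 9 `blockIter_stair_src`) AND ENDS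
(`blockIter_stair_tgt`: the last step lands on the corner `cornerN … ν`, whose coordinates are those of block corners of `x`,
`⌊Lⁱ⌊v/Lⁱ⌋/Lᵏ⌋ = ⌊v/Lᵏ⌋`) in `Bᵏ(x_k)`; so for `Ω` a union of `k`-blocks and `x ∈ Ω` they are bonds INSIDE `Ω`, and `A(Γ^{(k)}_{y,x})`
depends only on `A` there.  (ii) Hence `Q_k(B)u = Q_k(B′)u`, `Q_k^*(B)ψ = Q_k^*(B′)ψ`, `P_k(B)u = P_k(B′)u`,
`−Δ^{ε,N}_{B,Ω}u = −Δ^{ε,N}_{B′,Ω}u` and `H_k(Ω,B)u = H_k(Ω,B′)u` whenever `B = B′` on the bonds inside `Ω` and `u` is supported in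
`Ω` (`ψ` vanishing at the block points of `Ωᶜ`).  (iii) `G^ε_k(Ω,B)u` is supported in `Ω` (p35), so `H_k(Ω,B′)G^ε_k(Ω,B)u =
H_k(Ω,B)G^ε_k(Ω,B)u = u`, whence `G^ε_k(Ω,B)u = G^ε_k(Ω,B′)u` (`m² > 0`, `a_k ≥ 0`): the kernel `G^ε_k(Ω,B;x,x′)` with `x′ ∈ Ω` and
the background field (2.56) with `□₁ ⊆ □₂` depend only on `B` inside `Ω = Bᵏ(□₂)`.  (iv) If `Ω` lies in the window above a
corner `o` (no site on the hyperplanes `z_μ = o_μ − ε`; e.g. `Ω = Bᵏ(□₂)` for a proper box `□₂ = q + [0,S)^d` of `T^{(k)}`,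
`LᵏS < |T_ε|_μ`, `o = q̄` — `window_of_kbox`), every inside bond is off the seam, the seam field vanishes there, and F1's
identities become print's (2.73)/(2.74) literally, with `G^ε_k(Ω, A′)` — `A′ = 0` in print.

WHAT THIS FILE PROVES (kernel-checked, zero `sorry`; theorems only — NO definition, NO `Prop`-valued fact; axioms standard).
 §1 `blockIter_toFinest_blockIter`, `blockIter_cornerN_corners`, **`blockIter_stair_tgt`**, **`stair_bond_inside`**.
 §2 `multiContourSum_congr`, **`multiContourSum_congr_of_inside`**.
 §3 **`covLaplacianN_congr`** (any level, any `u`), `avgQk_congr_of_supported`, `avgQk_blockIter_eq_zero`,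
    `avgQkAdj_congr_of_supported`, `avgQkAdj_supported`, `projPk_congr_of_supported`, **`covOpK_congr_of_supported`**.
 §4 **`propagatorK_congr_of_supported`**, **`kernel_propagatorK_congr`**, `underRegion_blockIter`, **`bgScalar256_congr`**.
 §5 `seamField_eq_zero_of_inside`, **`kernel_propagatorK_constVec_local`** / **`kernel_propagatorK_constVec_zero`** (**(2.73) AS
    PRINTED**, `x′ ∈ Ω`), **`bgScalar256_constVec_local`** / **`bgScalar256_constVec_zero_apply`** (**(2.74) AS PRINTED**).
 §6 **`window_of_kbox`** (a proper box of `k`-sites lies in the window above its corner: the no-wrap hypothesis of §5 for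
    print's `□ = Bᵏ(□₂)`).

HONEST SCOPE / DIFFERENCES FROM PRINT (recorded, not hidden).  (a) Exact identities; hypotheses `m² > 0`, `a_k ≥ 0` (for the
two-sided inverse), `k ≤ K` (the `k`-blocks do not wrap), `Ω` a union of `k`-blocks (membership through `blockIter k` — weaker
than «sums of big blocks»), for §5 the window condition relative to a corner `o`.  (b) The gauge is based at a corner `o`
below `□` (forward staircases of the carrier), print's at the block point `y` with two-sided contours — the same rotation up to
the constant `εA₀(Γ_{o,y})` on `□` (F1 HONEST SCOPE (c)).  (c) In (2.73) the left point `x` is arbitrary, the right point `x′`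
must lie in `Ω` (for `x′ ∉ Ω` the kernel of the carrier's whole-torus operator is the decoupled `(m² + a_k(Lᵏε)⁻²P_k)⁻¹` block,
which does see the seam; print only uses `x, x′ ∈ □`).  (d) Nothing about (2.68), (2.75)–(2.77), (2.65)–(2.66) on this carrier
(bricks F3–F5 of the seat's programme).  Value = print's gauge step now holds VERBATIM for the carrier of record's `G^ε_k(□, ·)`
and `φ^{(k)}`; NOT summit progress.
-/

open scoped BigOperators

noncomputable section

namespace Literature.MathematicalPhysics.QuantumFieldTheory.Balaban1983to89.B2Eq273NeumannLocality

open Literature.MathematicalPhysics.QuantumFieldTheory.Balaban1983to89.HiggsLattice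
open Literature.MathematicalPhysics.QuantumFieldTheory.Balaban1983to89.HiggsAveraging
open Literature.MathematicalPhysics.QuantumFieldTheory.Balaban1983to89.HiggsCovariance
open Literature.MathematicalPhysics.QuantumFieldTheory.Balaban1983to89.HiggsCovariancePos
open Literature.MathematicalPhysics.QuantumFieldTheory.Balaban1983to89.HiggsGaugeInvariance (gaugeVec rot rot_neg_rot
  rot_rot_neg)
open Literature.MathematicalPhysics.QuantumFieldTheory.Balaban1983to89.B2Restr216Lattice (shiftN_succ shiftN_zero
  toFinest_zero cornerN cornerN_zero cornerN_d)
open Literature.MathematicalPhysics.QuantumFieldTheory.Balaban1983to89.B2Ineq329ZeroAveraging (val_blockIter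
  sitesPerDir_zero_eq)
open Literature.MathematicalPhysics.QuantumFieldTheory.Balaban1983to89.B2Ineq329PrismHolonomy (corner_eq_cornerN
  shiftN_cornerN_succ val_toFinest val_toFinest_blockIter blockIter_stair_src)
open Literature.MathematicalPhysics.QuantumFieldTheory.Balaban1983to89.B1Cor23RegularRegion (propagatorK_supported)
open Literature.MathematicalPhysics.QuantumFieldTheory.Balaban1983to89.B2Eq273GaugeCovariance

variable {P : HiggsLattice.Params} {N : ℕ}

/-! ## §1 The bonds of `Γ^{(k)}_{y,x}` lie in the block `Bᵏ(y)` -/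

section Geometry

variable {k : ℕ}

/-- `⌊(Lⁱ⌊v/Lⁱ⌋)/Lᵏ⌋ = ⌊v/Lᵏ⌋` for `i ≤ k`: the corner of the `i`-block of a site lies in its `k`-block. [folklore] -/
private theorem div_corner {i : ℕ} (hik : i ≤ k) (v : ℕ) : v / P.L ^ i * P.L ^ i / P.L ^ k = v / P.L ^ k := by
  have hLi : 0 < P.L ^ i := pow_pos P.hL i
  obtain ⟨j, rfl⟩ := Nat.exists_eq_add_of_le hik
  rw [pow_add, ← Nat.div_div_eq_div_mul, ← Nat.div_div_eq_div_mul, Nat.mul_div_cancel _ hLi]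

/-- the corner `toFinest (x_i)` of the `i`-block of `x` lies in the `k`-block of `x` (`i ≤ k ≤ K`).
[cite: Balaban1982Higgs1, (1.20) p.607] -/
theorem blockIter_toFinest_blockIter {i : ℕ} (hik : i ≤ k) (hk : k ≤ P.K) (x : HiggsLattice.Site P 0) :
    blockIter k (toFinest (blockIter i x)) = blockIter k x := by
  funext ν
  apply ZMod.val_injective
  rw [val_blockIter hk, val_blockIter hk, val_toFinest_blockIter (hik.trans hk), div_corner hik]

/-- every corner of the level-`i` staircase piece of `Γ^{(k)}_{y,x}` (between the corners `toFinest x_{i+1}` and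
`toFinest x_i`) lies in `Bᵏ(y)`, `y = x_k` (`i < k ≤ K`). [cite: Balaban1982Higgs1, (2.2) p.608] -/
theorem blockIter_cornerN_corners {i : ℕ} (hik : i < k) (hk : k ≤ P.K) (x : HiggsLattice.Site P 0) (t : ℕ) :
    blockIter k (cornerN (toFinest (blockIter (i + 1) x)) (toFinest (blockIter i x)) t) = blockIter k x := by
  funext ν
  apply ZMod.val_injective
  rw [val_blockIter hk, val_blockIter hk]
  simp only [cornerN]
  split_ifs
  · rw [val_toFinest_blockIter (by omega : i + 1 ≤ P.K), div_corner (by omega : i + 1 ≤ k)]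
  · rw [val_toFinest_blockIter (by omega : i ≤ P.K), div_corner hik.le]

/-- **the bonds of `Γ^{(k)}_{y,x}` END in `Bᵏ(y)`** (companion of own gen 9's `blockIter_stair_src`, which says they start
there): the target of the bond `⟨cornerN(ν+1) + sεe_ν, ν⟩`, `s < m_{i,ν}`, of the level-`i` staircase has `k`-block point `x_k`.
[cite: Balaban1982Higgs1, (2.2) p.608] -/
theorem blockIter_stair_tgt {i : ℕ} (hik : i < k) (hk : k ≤ P.K) (x : HiggsLattice.Site P 0) (ν : Fin P.d) {s : ℕ}
    (hs : s < ((toFinest (blockIter i x)) ν - (toFinest (blockIter (i + 1) x)) ν).val) :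
    blockIter k ((shiftN (cornerN (toFinest (blockIter (i + 1) x)) (toFinest (blockIter i x)) (ν + 1)) ν s).shift ν)
      = blockIter k x := by
  rw [shiftN_succ]
  by_cases h : s + 1 < ((toFinest (blockIter i x)) ν - (toFinest (blockIter (i + 1) x)) ν).val
  · exact blockIter_stair_src hik hk x ν h
  · have he : s + 1 = ((toFinest (blockIter i x)) ν - (toFinest (blockIter (i + 1) x)) ν).val := by omega
    rw [he, shiftN_cornerN_succ]
    exact blockIter_cornerN_corners hik hk x ν

/-- **the bonds of `Γ^{(k)}_{y,x}` are INSIDE every union of `k`-blocks containing `x`**: for `Ω ⊂ T_ε` whose membership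
depends on the `k`-block point only and `x ∈ Ω`, every bond of the composite contour (2.2) has both endpoints in `Ω`.
[cite: Balaban1982Higgs1, (2.2) p.608] -/
theorem stair_bond_inside {Ω : Finset (HiggsLattice.Site P 0)}
    (hΩ : ∀ x x' : HiggsLattice.Site P 0, blockIter k x = blockIter k x' → (x ∈ Ω ↔ x' ∈ Ω)) (hk : k ≤ P.K) {x : HiggsLattice.Site P 0}
    (hx : x ∈ Ω) {i : ℕ} (hik : i < k) (ν : Fin P.d) {s : ℕ}
    (hs : s < ((toFinest (blockIter i x)) ν - (toFinest (blockIter (i + 1) x)) ν).val) :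
    Inside Ω ⟨shiftN (cornerN (toFinest (blockIter (i + 1) x)) (toFinest (blockIter i x)) (ν + 1)) ν s, ν⟩ :=
  ⟨(hΩ _ x (blockIter_stair_src hik hk x ν hs)).mpr hx, (hΩ _ x (blockIter_stair_tgt hik hk x ν hs)).mpr hx⟩

end Geometry

/-! ## §2 `A(Γ^{(k)}_{y,x})` depends only on `A` on the bonds of the contour -/

section ContourCongr

variable {k : ℕ}

/-- two vector fields agreeing on the bonds of `Γ^{(k)}_{y,x}` have the same contour sum (2.2)/(2.3).
[cite: Balaban1982Higgs1, (2.2)–(2.3) p.608] -/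
theorem multiContourSum_congr {B B' : HiggsLattice.VecField P 0} (k : ℕ) (x : HiggsLattice.Site P 0)
    (h : ∀ i, i < k → ∀ (ν : Fin P.d) (s : ℕ),
      s < ((toFinest (blockIter i x)) ν - (toFinest (blockIter (i + 1) x)) ν).val →
      B ⟨shiftN (cornerN (toFinest (blockIter (i + 1) x)) (toFinest (blockIter i x)) (ν + 1)) ν s, ν⟩
        = B' ⟨shiftN (cornerN (toFinest (blockIter (i + 1) x)) (toFinest (blockIter i x)) (ν + 1)) ν s, ν⟩) :
    multiContourSum B k x = multiContourSum B' k x := by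
  unfold multiContourSum
  refine Finset.sum_congr rfl fun i hi => ?_
  unfold contourSum
  refine Finset.sum_congr rfl fun ν _ => ?_
  rw [corner_eq_cornerN]
  unfold segSum
  exact Finset.sum_congr rfl fun s hs => h i (Finset.mem_range.1 hi) ν s (Finset.mem_range.1 hs)

/-- **`A(Γ^{(k)}_{y,x})` for `x ∈ Ω` depends only on `A` on the bonds INSIDE `Ω`** (`Ω` a union of `k`-blocks, `k ≤ K`).
[cite: Balaban1982Higgs1, (2.2)–(2.3) p.608] -/
theorem multiContourSum_congr_of_inside {Ω : Finset (HiggsLattice.Site P 0)}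
    (hΩ : ∀ x x' : HiggsLattice.Site P 0, blockIter k x = blockIter k x' → (x ∈ Ω ↔ x' ∈ Ω)) (hk : k ≤ P.K)
    {B B' : HiggsLattice.VecField P 0} (hB : ∀ b : HiggsLattice.PBond P 0, Inside Ω b → B b = B' b) {x : HiggsLattice.Site P 0} (hx : x ∈ Ω) :
    multiContourSum B k x = multiContourSum B' k x :=
  multiContourSum_congr k x fun _ hik ν _ hs => hB _ (stair_bond_inside hΩ hk hx hik ν hs)

end ContourCongr

/-! ## §3 LOCALITY IN THE FIELD: `H_k(Ω, A)u`, `u` supported in `Ω`, depends only on `A` on the bonds inside `Ω` -/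

section FieldLocality

variable (C : ChargeData N)

/-- **the Neumann Laplacian of `Ω` sees only the bonds inside `Ω`**: `−Δ^{η,N}_{B,Ω} = −Δ^{η,N}_{B′,Ω}` whenever `B = B′` on the
bonds with both endpoints in `Ω` (any level, any field, no support condition). [cite: Balaban1982Higgs1, (2.17) p.610] -/
theorem covLaplacianN_congr {k : ℕ} (Ω : Finset (HiggsLattice.Site P k)) {B B' : HiggsLattice.VecField P k}
    (hB : ∀ b : HiggsLattice.PBond P k, Inside Ω b → B b = B' b) (u : HiggsLattice.ScalarField P k N) :
    covLaplacianN C Ω B u = covLaplacianN C Ω B' u := by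
  funext x
  have happ : ∀ (A : HiggsLattice.VecField P k), covLaplacianN C Ω A u x
      = ((P.mesh k)⁻¹ ^ 2) • ∑ μ : Fin P.d, (fwdTerm C Ω A x μ u + bwdTerm C Ω A x μ u) := by
    intro A
    simp only [covLaplacianN, LinearMap.pi_apply, LinearMap.smul_apply, LinearMap.coe_sum, Finset.sum_apply,
      LinearMap.add_apply]
  have hfwd : ∀ (A : HiggsLattice.VecField P k) (μ : Fin P.d), fwdTerm C Ω A x μ u
      = if x ∈ Ω ∧ x.shift μ ∈ Ω then u x - C.U (P.mesh k) (A ⟨x, μ⟩) (u (x.shift μ)) else 0 := by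
    intro A μ
    unfold fwdTerm
    split_ifs <;> simp
  have hbwd : ∀ (A : HiggsLattice.VecField P k) (μ : Fin P.d), bwdTerm C Ω A x μ u
      = if x ∈ Ω ∧ x.unshift μ ∈ Ω then u x - star (C.U (P.mesh k) (A ⟨x.unshift μ, μ⟩)) (u (x.unshift μ))
        else 0 := by
    intro A μ
    unfold bwdTerm
    split_ifs <;> simp
  rw [happ, happ]
  congr 1
  refine Finset.sum_congr rfl fun μ _ => ?_
  rw [hfwd, hfwd, hbwd, hbwd]
  congr 1
  · split_ifs with h
    · rw [hB ⟨x, μ⟩ ⟨h.1, h.2⟩]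
    · rfl
  · split_ifs with h
    · rw [hB ⟨x.unshift μ, μ⟩ ⟨h.2, by change (x.unshift μ).shift μ ∈ Ω; rw [shift_unshift]; exact h.1⟩]
    · rfl

variable {k : ℕ} {Ω : Finset (HiggsLattice.Site P 0)}

/-- **`Q_k(B)u = Q_k(B′)u` for `u` supported in `Ω`** (a union of `k`-blocks, `k ≤ K`) whenever `B = B′` on the bonds inside `Ω`:
the contours of the sites of `Ω` stay inside `Ω`, the other sites carry `u = 0`. [cite: Balaban1982Higgs1, (2.11) p.609] -/
theorem avgQk_congr_of_supported
    (hΩ : ∀ x x' : HiggsLattice.Site P 0, blockIter k x = blockIter k x' → (x ∈ Ω ↔ x' ∈ Ω)) (hk : k ≤ P.K)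
    {B B' : HiggsLattice.VecField P 0} (hB : ∀ b : HiggsLattice.PBond P 0, Inside Ω b → B b = B' b)
    (u : HiggsLattice.ScalarField P 0 N) (hu : ∀ x, x ∉ Ω → u x = 0) :
    avgQk C B k u = avgQk C B' k u := by
  funext y
  rw [avgQk_apply, avgQk_apply]
  congr 1
  refine Finset.sum_congr rfl fun x _ => ?_
  by_cases hx : x ∈ Ω
  · rw [multiContourSum_congr_of_inside hΩ hk hB hx]
  · rw [hu x hx, map_zero, map_zero]

/-- `Q_k(B)u` vanishes at the block points of `Ωᶜ` when `u` is supported in `Ω`. [cite: Balaban1982Higgs1, (2.11) p.609] -/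
theorem avgQk_blockIter_eq_zero
    (hΩ : ∀ x x' : HiggsLattice.Site P 0, blockIter k x = blockIter k x' → (x ∈ Ω ↔ x' ∈ Ω))
    (B : HiggsLattice.VecField P 0) (u : HiggsLattice.ScalarField P 0 N) (hu : ∀ x, x ∉ Ω → u x = 0)
    {x : HiggsLattice.Site P 0} (hx : x ∉ Ω) : avgQk C B k u (blockIter k x) = 0 := by
  rw [avgQk_apply]
  refine smul_eq_zero_of_right _ (Finset.sum_eq_zero fun x' hx' => ?_)
  have hx'Ω : x' ∉ Ω := fun h => hx ((hΩ x' x ((mem_blockK k _ x').1 hx')).mp h)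
  rw [hu x' hx'Ω, map_zero]

/-- **`Q_k^*(B)ψ = Q_k^*(B′)ψ`** when `B = B′` on the bonds inside `Ω` and `ψ` vanishes at the block points of `Ωᶜ`.
[cite: Balaban1982Higgs1, (2.20) p.610] -/
theorem avgQkAdj_congr_of_supported
    (hΩ : ∀ x x' : HiggsLattice.Site P 0, blockIter k x = blockIter k x' → (x ∈ Ω ↔ x' ∈ Ω)) (hk : k ≤ P.K)
    {B B' : HiggsLattice.VecField P 0} (hB : ∀ b : HiggsLattice.PBond P 0, Inside Ω b → B b = B' b)
    (ψ : HiggsLattice.ScalarField P k N) (hψ : ∀ x : HiggsLattice.Site P 0, x ∉ Ω → ψ (blockIter k x) = 0) :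
    avgQkAdj C B k ψ = avgQkAdj C B' k ψ := by
  funext x
  change star (C.U (P.mesh 0) (multiContourSum B k x)) (ψ (blockIter k x))
    = star (C.U (P.mesh 0) (multiContourSum B' k x)) (ψ (blockIter k x))
  by_cases hx : x ∈ Ω
  · rw [multiContourSum_congr_of_inside hΩ hk hB hx]
  · rw [hψ x hx, map_zero, map_zero]

/-- `Q_k^*(B)ψ` is supported in `Ω` when `ψ` vanishes at the block points of `Ωᶜ`. [cite: Balaban1982Higgs1, (2.20) p.610] -/
theorem avgQkAdj_supported (B : HiggsLattice.VecField P 0) (ψ : HiggsLattice.ScalarField P k N)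
    (hψ : ∀ x : HiggsLattice.Site P 0, x ∉ Ω → ψ (blockIter k x) = 0) :
    ∀ x, x ∉ Ω → avgQkAdj C B k ψ x = 0 := by
  intro x hx
  change star (C.U (P.mesh 0) (multiContourSum B k x)) (ψ (blockIter k x)) = 0
  rw [hψ x hx, map_zero]

/-- **`P_k(B)u = P_k(B′)u` for `u` supported in `Ω`** (`B = B′` inside `Ω`). [cite: Balaban1982Higgs1, (2.20) p.610] -/
theorem projPk_congr_of_supported
    (hΩ : ∀ x x' : HiggsLattice.Site P 0, blockIter k x = blockIter k x' → (x ∈ Ω ↔ x' ∈ Ω)) (hk : k ≤ P.K)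
    {B B' : HiggsLattice.VecField P 0} (hB : ∀ b : HiggsLattice.PBond P 0, Inside Ω b → B b = B' b)
    (u : HiggsLattice.ScalarField P 0 N) (hu : ∀ x, x ∉ Ω → u x = 0) :
    projPk C B k u = projPk C B' k u := by
  have hlin : ∀ A : HiggsLattice.VecField P 0, avgQkLin C A k u = avgQk C A k u :=
    fun A => funext fun y => avgQkLin_apply C A k u y
  unfold projPk
  rw [LinearMap.comp_apply, LinearMap.comp_apply, hlin, hlin, avgQk_congr_of_supported C hΩ hk hB u hu]
  exact avgQkAdj_congr_of_supported C hΩ hk hB _ fun x hx => avgQk_blockIter_eq_zero C hΩ B' u hu hx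

/-- **LOCALITY OF `H_k(Ω, ·)` IN THE FIELD**: `H_k(Ω, B)u = H_k(Ω, B′)u` for every `u` supported in `Ω` (a union of
`k`-blocks, `k ≤ K`) whenever `B = B′` on the bonds inside `Ω` — the operator of (2.20) «on functions φ : Ω → R^N» is
determined by the field on `Ω`. [cite: Balaban1982Higgs1, (2.20) p.610] -/
theorem covOpK_congr_of_supported
    (hΩ : ∀ x x' : HiggsLattice.Site P 0, blockIter k x = blockIter k x' → (x ∈ Ω ↔ x' ∈ Ω)) (hk : k ≤ P.K)
    {B B' : HiggsLattice.VecField P 0} (hB : ∀ b : HiggsLattice.PBond P 0, Inside Ω b → B b = B' b) (msq a : ℝ)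
    (u : HiggsLattice.ScalarField P 0 N) (hu : ∀ x, x ∉ Ω → u x = 0) :
    covOpK C Ω B msq a k u = covOpK C Ω B' msq a k u := by
  unfold covOpK
  simp only [LinearMap.add_apply, LinearMap.smul_apply, LinearMap.id_apply]
  rw [covLaplacianN_congr C Ω hB u, projPk_congr_of_supported C hΩ hk hB u hu]

end FieldLocality

/-! ## §4 LOCALITY OF THE PROPAGATOR `G^ε_k(Ω, A)` IN THE FIELD (sources supported in `Ω`) -/

section PropagatorLocality

variable (C : ChargeData N) {k : ℕ} {Ω : Finset (HiggsLattice.Site P 0)}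

/-- **`G^ε_k(Ω, B)u = G^ε_k(Ω, B′)u` for `u` supported in `Ω`** (`m² > 0`, `a_k ≥ 0`, `Ω` a union of `k`-blocks, `k ≤ K`)
whenever `B = B′` on the bonds inside `Ω`: by p35's `B1Cor23RegularRegion.propagatorK_supported` the solution `G(B)u` is
supported in `Ω`, so `H(B′)` acts on it as `H(B)` does. [cite: Balaban1982Higgs1, (2.20) p.610] -/
theorem propagatorK_congr_of_supported {msq a : ℝ} (hmsq : 0 < msq) (hak : 0 ≤ B1.aSeq a P.L k)
    (hΩ : ∀ x x' : HiggsLattice.Site P 0, blockIter k x = blockIter k x' → (x ∈ Ω ↔ x' ∈ Ω)) (hk : k ≤ P.K)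
    {B B' : HiggsLattice.VecField P 0} (hB : ∀ b : HiggsLattice.PBond P 0, Inside Ω b → B b = B' b)
    (u : HiggsLattice.ScalarField P 0 N) (hu : ∀ x, x ∉ Ω → u x = 0) :
    propagatorK C Ω B msq a k u = propagatorK C Ω B' msq a k u := by
  have hv : ∀ x, x ∉ Ω → propagatorK C Ω B msq a k u x = 0 := propagatorK_supported C Ω B hmsq hak hΩ u hu
  have h1 : covOpK C Ω B' msq a k (propagatorK C Ω B msq a k u) = u := by
    rw [← covOpK_congr_of_supported C hΩ hk hB msq a _ hv]
    exact covOpK_propagatorK_apply C Ω B hmsq a k hak u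
  have h2 := congrArg (propagatorK C Ω B' msq a k) h1
  rw [propagatorK_covOpK_apply C Ω B' hmsq a k hak] at h2
  exact h2

/-- unfolding of the typer's `kernel` (level `0`; private plumbing). [cite: Balaban1982Higgs1, (2.24) p.610] -/
private theorem kernel_apply' (G : Module.End ℝ (HiggsLattice.ScalarField P 0 N)) (x x' : HiggsLattice.Site P 0) (v : E N) :
    kernel G x x' v = G (Pi.single x' v) x := by
  simp [kernel]

/-- **the kernel `G^ε_k(Ω, B; x, x′)` with `x′ ∈ Ω` depends only on `B` inside `Ω`**. [cite: Balaban1982Higgs1, (2.24) p.610] -/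
theorem kernel_propagatorK_congr {msq a : ℝ} (hmsq : 0 < msq) (hak : 0 ≤ B1.aSeq a P.L k)
    (hΩ : ∀ x x' : HiggsLattice.Site P 0, blockIter k x = blockIter k x' → (x ∈ Ω ↔ x' ∈ Ω)) (hk : k ≤ P.K)
    {B B' : HiggsLattice.VecField P 0} (hB : ∀ b : HiggsLattice.PBond P 0, Inside Ω b → B b = B' b)
    (x : HiggsLattice.Site P 0) {x' : HiggsLattice.Site P 0} (hx' : x' ∈ Ω) (v : E N) :
    kernel (propagatorK C Ω B msq a k) x x' v = kernel (propagatorK C Ω B' msq a k) x x' v := by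
  rw [kernel_apply', kernel_apply', propagatorK_congr_of_supported C hmsq hak hΩ hk hB]
  intro z hz
  have : z ≠ x' := fun h => hz (h ▸ hx')
  simp [this]

/-- `Bᵏ(Λ₂)` (`underRegion`) is a union of `k`-blocks. [cite: Balaban1982Higgs2, (2.56) p.570] -/
theorem underRegion_blockIter (Λ₂ : Finset (HiggsLattice.Site P k)) (x x' : HiggsLattice.Site P 0)
    (h : blockIter k x = blockIter k x') :
    x ∈ B2Eq255Concrete.underRegion k Λ₂ ↔ x' ∈ B2Eq255Concrete.underRegion k Λ₂ := by
  rw [B2Eq255Concrete.mem_underRegion, B2Eq255Concrete.mem_underRegion, h]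

/-- **LOCALITY OF THE BACKGROUND FIELD (2.56) IN THE VECTOR FIELD**: `φ^{(k)} = a_k(Lᵏε)⁻²G^ε_k(Bᵏ(Λ₂),B)Q_k^*(B)(Λ₁φ)` with
`Λ₁ ⊆ Λ₂` depends only on `B` on the bonds inside `Bᵏ(Λ₂)` (`m² > 0`, `a_k ≥ 0`, `k ≤ K`). [cite: Balaban1982Higgs2, (2.56) p.570] -/
theorem bgScalar256_congr {msq a : ℝ} (hmsq : 0 < msq) (hak : 0 ≤ B1.aSeq a P.L k) (hk : k ≤ P.K)
    (Λ₂ Λ₁ : Finset (HiggsLattice.Site P k)) (h12 : Λ₁ ⊆ Λ₂) {B B' : HiggsLattice.VecField P 0}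
    (hB : ∀ b : HiggsLattice.PBond P 0, Inside (B2Eq255Concrete.underRegion k Λ₂) b → B b = B' b)
    (φ : HiggsLattice.ScalarField P k N) :
    B2Eq255Concrete.bgScalar256 C msq a k Λ₂ Λ₁ B φ = B2Eq255Concrete.bgScalar256 C msq a k Λ₂ Λ₁ B' φ := by
  have hΩ := underRegion_blockIter (P := P) Λ₂
  have hψ : ∀ x : HiggsLattice.Site P 0, x ∉ B2Eq255Concrete.underRegion k Λ₂ →
      B2Eq255Concrete.cutTo Λ₁ φ (blockIter k x) = 0 := by
    intro x hx
    rw [B2Eq255Concrete.mem_underRegion] at hx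
    exact B2Eq255Concrete.cutTo_of_not_mem Λ₁ φ fun h => hx (h12 h)
  rw [B2Eq255Concrete.bgScalar256_eq, B2Eq255Concrete.bgScalar256_eq, avgQkAdj_congr_of_supported C hΩ hk hB _ hψ,
    propagatorK_congr_of_supported C hmsq hak hΩ hk hB _ (avgQkAdj_supported C B' _ hψ)]

end PropagatorLocality

/-! ## §5 Print's (2.73)/(2.74) LITERALLY: the constant field gauged to zero on a region off the seam -/

section Printed

variable (C : ChargeData N) {k : ℕ} {Ω : Finset (HiggsLattice.Site P 0)}

/-- in a region lying in the window above the corner `o` (no site of `Ω` on the hyperplanes `z_μ = o_μ − ε`) every inside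
bond is off the seam, so the seam field `A₀ − ∂λ_o` of `B2Eq273GaugeCovariance` vanishes inside `Ω`.
[cite: Balaban1982Higgs2, Lemma 2.4 proof (2.70) p.572] -/
theorem seamField_eq_zero_of_inside (o : HiggsLattice.Site P 0) (c : Fin P.d → ℝ)
    (hwin : ∀ z ∈ Ω, ∀ μ : Fin P.d, (z μ - o μ).val + 1 < P.sitesPerDir 0 μ)
    (b : HiggsLattice.PBond P 0) (hb : Inside Ω b) : seamField o c b = 0 := by
  obtain ⟨z, μ⟩ := b
  exact seamField_eq_zero_of_noWrap o c (hwin z hb.1 μ)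

/-- **(2.73) AS PRINTED**: for `Ω` a union of `k`-blocks in the window above `o` (`m² > 0`, `a_k ≥ 0`, `k ≤ K`), a constant
field `A₀` (values `c`) and any `A′`, at every `x′ ∈ Ω`:
`G^ε_k(Ω, A₀ + A′; x, x′) = U(A₀(Γ_{x,o})) · G^ε_k(Ω, A′; x, x′) · U(A₀(Γ_{o,x′}))` — print's display is `A′ = 0`:
«G_k(□, A₀; x, x′) = U(A₀(Γ_{x,y}))G_k(□, 0; x, x′)U(A₀(Γ_{y,x′})) (2.73)» (gauge based at the corner `o` instead of `y`,
cf. `B2Eq273GaugeCovariance` HONEST SCOPE (c)). [cite: Balaban1982Higgs2, Lemma 2.4 proof (2.73) p.573] -/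
theorem kernel_propagatorK_constVec_local {msq a : ℝ} (hmsq : 0 < msq) (hak : 0 ≤ B1.aSeq a P.L k)
    (hΩ : ∀ x x' : HiggsLattice.Site P 0, blockIter k x = blockIter k x' → (x ∈ Ω ↔ x' ∈ Ω)) (hk : k ≤ P.K)
    (o : HiggsLattice.Site P 0) (hwin : ∀ z ∈ Ω, ∀ μ : Fin P.d, (z μ - o μ).val + 1 < P.sitesPerDir 0 μ)
    (c : Fin P.d → ℝ) (A' : HiggsLattice.VecField P 0) (x : HiggsLattice.Site P 0) {x' : HiggsLattice.Site P 0}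
    (hx' : x' ∈ Ω) (v : E N) :
    kernel (propagatorK C Ω (constVec c + A') msq a k) x x' v
      = C.U (P.mesh 0) (-contourSum (constVec c) o x)
          (kernel (propagatorK C Ω A' msq a k) x x' (C.U (P.mesh 0) (contourSum (constVec c) o x') v)) := by
  rw [kernel_propagatorK_constVec C Ω o c A' msq a k x x' v,
    kernel_propagatorK_congr C hmsq hak hΩ hk (B := A' + seamField o c) (B' := A')
      (fun b hb => by rw [Pi.add_apply, seamField_eq_zero_of_inside o c hwin b hb, add_zero]) x hx' _]

/-- (2.73) as printed, `A′ = 0`: `G^ε_k(Ω, A₀; x, x′) = U(A₀(Γ_{x,o}))G^ε_k(Ω, 0; x, x′)U(A₀(Γ_{o,x′}))`, `x′ ∈ Ω`.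
[cite: Balaban1982Higgs2, Lemma 2.4 proof (2.73) p.573] -/
theorem kernel_propagatorK_constVec_zero {msq a : ℝ} (hmsq : 0 < msq) (hak : 0 ≤ B1.aSeq a P.L k)
    (hΩ : ∀ x x' : HiggsLattice.Site P 0, blockIter k x = blockIter k x' → (x ∈ Ω ↔ x' ∈ Ω)) (hk : k ≤ P.K)
    (o : HiggsLattice.Site P 0) (hwin : ∀ z ∈ Ω, ∀ μ : Fin P.d, (z μ - o μ).val + 1 < P.sitesPerDir 0 μ)
    (c : Fin P.d → ℝ) (x : HiggsLattice.Site P 0) {x' : HiggsLattice.Site P 0} (hx' : x' ∈ Ω) (v : E N) :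
    kernel (propagatorK C Ω (constVec c) msq a k) x x' v
      = C.U (P.mesh 0) (-contourSum (constVec c) o x)
          (kernel (propagatorK C Ω (0 : HiggsLattice.VecField P 0) msq a k) x x'
            (C.U (P.mesh 0) (contourSum (constVec c) o x') v)) := by
  have h := kernel_propagatorK_constVec_local C hmsq hak hΩ hk o hwin c 0 x hx' v
  rwa [add_zero] at h

/-- **(2.74) AS PRINTED**: for `□₁ ⊆ □₂ ⊂ T^{(k)}` with `□ = Bᵏ(□₂)` in the window above `o` (`m² > 0`, `a_k ≥ 0`, `k ≤ K`),
a constant `A₀` and any `A′`: `φ^{(k)}_{□}[A₀ + A′, φ] = U(A₀(Γ_{·,o}))·φ^{(k)}_{□}[A′, φ′]`, `φ′(y′) = U(A₀(Γ_{o,ȳ′}))φ(y′)` — print's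
«(a_kG_k(□, A₀)Q_k^*(A₀)□₁φ)(x) = U(A₀(Γ_{x,y}))(a_kG_k(□, 0)Q_k^*□₁φ′)(x) (2.74)» is `A′ = 0`.
[cite: Balaban1982Higgs2, Lemma 2.4 proof (2.74) p.573] -/
theorem bgScalar256_constVec_local {msq a : ℝ} (hmsq : 0 < msq) (hak : 0 ≤ B1.aSeq a P.L k) (hk : k ≤ P.K)
    (sq₂ sq₁ : Finset (HiggsLattice.Site P k)) (h12 : sq₁ ⊆ sq₂) (o : HiggsLattice.Site P 0)
    (hwin : ∀ z ∈ B2Eq255Concrete.underRegion k sq₂, ∀ μ : Fin P.d, (z μ - o μ).val + 1 < P.sitesPerDir 0 μ)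
    (c : Fin P.d → ℝ) (A' : HiggsLattice.VecField P 0) (φ : HiggsLattice.ScalarField P k N) :
    B2Eq255Concrete.bgScalar256 C msq a k sq₂ sq₁ (constVec c + A') φ
      = rot C (-cornerGauge o c)
          (B2Eq255Concrete.bgScalar256 C msq a k sq₂ sq₁ A' (rot C (fun y => cornerGauge o c (toFinest y)) φ)) := by
  rw [bgScalar256_constVec C msq a k sq₂ sq₁ o c A' φ,
    bgScalar256_congr C hmsq hak hk sq₂ sq₁ h12 (B := A' + seamField o c) (B' := A')
      (fun b hb => by rw [Pi.add_apply, seamField_eq_zero_of_inside o c hwin b hb, add_zero])]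

/-- (2.74) as printed, `A′ = 0`, at a site: `φ^{(k)}_{□}[A₀, φ](x) = U(A₀(Γ_{x,o}))·φ^{(k)}_{□}[0, φ′](x)`.
[cite: Balaban1982Higgs2, Lemma 2.4 proof (2.74) p.573] -/
theorem bgScalar256_constVec_zero_apply {msq a : ℝ} (hmsq : 0 < msq) (hak : 0 ≤ B1.aSeq a P.L k) (hk : k ≤ P.K)
    (sq₂ sq₁ : Finset (HiggsLattice.Site P k)) (h12 : sq₁ ⊆ sq₂) (o : HiggsLattice.Site P 0)
    (hwin : ∀ z ∈ B2Eq255Concrete.underRegion k sq₂, ∀ μ : Fin P.d, (z μ - o μ).val + 1 < P.sitesPerDir 0 μ)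
    (c : Fin P.d → ℝ) (φ : HiggsLattice.ScalarField P k N) (x : HiggsLattice.Site P 0) :
    B2Eq255Concrete.bgScalar256 C msq a k sq₂ sq₁ (constVec c) φ x
      = C.U (P.mesh 0) (-contourSum (constVec c) o x)
          (B2Eq255Concrete.bgScalar256 C msq a k sq₂ sq₁ (0 : HiggsLattice.VecField P 0)
            (rot C (fun y => cornerGauge o c (toFinest y)) φ) x) := by
  have h := bgScalar256_constVec_local C hmsq hak hk sq₂ sq₁ h12 o hwin c 0 φ
  rw [add_zero] at h
  rw [h]
  change C.U (P.mesh 0) ((P.mesh 0)⁻¹ * (-cornerGauge o c) x) _ = _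
  rw [Pi.neg_apply, (U_cornerGauge C o c x).2]

end Printed

/-! ## §6 Print's `□ = Bᵏ(□₂)` lies in a window: discharging the no-wrap hypothesis for a box of `k`-sites -/

section Window

variable {k : ℕ}

/-- **a box of `k`-sites that does not wrap lies in the window above its corner**: if every `y ∈ □₂` has
`(y_μ − q_μ) mod |T^{(k)}|_μ < S` with `LᵏS < |T_ε|_μ` (the box `q + [0,S)^d` of `T^{(k)}` is a proper sub-box of the torus),
then every site `z ∈ □ = Bᵏ(□₂)` satisfies the no-wrap condition `n_μ(z) + 1 < |T_ε|_μ` relative to the corner `o = q̄`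
(`= toFinest q`), i.e. `□` misses the seam of the corner gauge `λ_o` — the geometry of print's «□ = Bᵏ(□₂)», `□₂` the blocks
within `4r(Lᵏε)` of `y`. [cite: Balaban1982Higgs2, Lemma 2.4 proof p.572 «let us denote □ = Bᵏ(□₂)»] -/
theorem window_of_kbox (hk : k ≤ P.K) (q : HiggsLattice.Site P k) (S : ℕ)
    (hS : ∀ μ : Fin P.d, P.L ^ k * S < P.sitesPerDir 0 μ) (sq : Finset (HiggsLattice.Site P k))
    (hsq : ∀ y ∈ sq, ∀ μ : Fin P.d, (y μ - q μ).val < S) :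
    ∀ z ∈ B2Eq255Concrete.underRegion k sq, ∀ μ : Fin P.d, (z μ - toFinest q μ).val + 1 < P.sitesPerDir 0 μ := by
  intro z hz μ
  rw [B2Eq255Concrete.mem_underRegion] at hz
  set y := blockIter k z with hy
  have hn := sitesPerDir_zero_eq (P := P) hk μ
  have hLk : 0 < P.L ^ k := pow_pos P.hL k
  -- the labels as natural numbers
  set a := (z μ).val with ha
  set t := (y μ - q μ).val with ht
  have htS : t < S := hsq y hz μ
  have hb : (y μ).val = a / P.L ^ k := by rw [hy, val_blockIter hk]
  have ho : (toFinest q μ).val = (q μ).val * P.L ^ k := val_toFinest hk q μ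
  -- `y_μ ≡ q_μ + t (mod |T^{(k)}|_μ)`
  have hyq : (y μ).val ≡ (q μ).val + t [MOD P.sitesPerDir k μ] := by
    have e : y μ = q μ + (y μ - q μ) := by ring
    have := congrArg ZMod.val e
    rw [ZMod.val_add] at this
    rw [this, ht]
    exact Nat.mod_modEq _ _
  -- `z_μ ≡ Lᵏ(q_μ + t) + r (mod |T_ε|_μ)`, `r = z_μ mod Lᵏ`
  have hmain : a ≡ (q μ).val * P.L ^ k + (P.L ^ k * t + a % P.L ^ k) [MOD P.sitesPerDir 0 μ] := by
    have h1 : a = P.L ^ k * (a / P.L ^ k) + a % P.L ^ k := (Nat.div_add_mod a (P.L ^ k)).symm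
    have h2 : P.L ^ k * (a / P.L ^ k) ≡ P.L ^ k * ((q μ).val + t) [MOD P.sitesPerDir 0 μ] := by
      rw [hn]
      exact (Nat.ModEq.mul_left' (P.L ^ k) (hb ▸ hyq))
    calc a = P.L ^ k * (a / P.L ^ k) + a % P.L ^ k := h1
      _ ≡ P.L ^ k * ((q μ).val + t) + a % P.L ^ k [MOD P.sitesPerDir 0 μ] := Nat.ModEq.add_right _ h2
      _ = (q μ).val * P.L ^ k + (P.L ^ k * t + a % P.L ^ k) := by ring
  have hzo : z μ - toFinest q μ = ((P.L ^ k * t + a % P.L ^ k : ℕ) : ZMod (P.sitesPerDir 0 μ)) := by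
    rw [← ZMod.natCast_zmod_val (z μ), ← ZMod.natCast_zmod_val (toFinest q μ), ← ha, ho, sub_eq_iff_eq_add,
      ← Nat.cast_add, ZMod.natCast_eq_natCast_iff, add_comm]
    exact hmain
  have hlt : P.L ^ k * t + a % P.L ^ k + 1 ≤ P.L ^ k * S := by
    have hr : a % P.L ^ k < P.L ^ k := Nat.mod_lt _ hLk
    have : P.L ^ k * (t + 1) ≤ P.L ^ k * S := Nat.mul_le_mul_left _ htS
    rw [mul_add, mul_one] at this
    omega
  rw [hzo, ZMod.val_natCast, Nat.mod_eq_of_lt (by have := hS μ; omega)]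
  exact lt_of_le_of_lt hlt (hS μ)

end Window

end Literature.MathematicalPhysics.QuantumFieldTheory.Balaban1983to89.B2Eq273NeumannLocality

end
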